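import Mathlib
import HarnessLib
import Summits.AnomalousDissipation.AnomalousDissipation.Theses.TaylorCertificates
import Summits.AnomalousDissipation.AnomalousDissipation.Theorems.FloorCertificate.Negative.WeakDuality
import Literature.Analysis.FluidPDE.StatisticalSolution
import Literature.Analysis.FluidPDE.StatisticalSolutionEnergyEq
import Literature.Analysis.FluidPDE.StatisticalSolutionProofs

/-!
# Sketch — crux `TaylorCertificates.FloorCertificateEnsembleCeiling` (stmt-AnomalousDissipation-14086),
crux-ideate round 1, ideator 3

First lemmas of the two idea cards of this seat, stated over existing declarations and — for the
GLUE statements — proved: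

* §0 `XFor f` = the inner block of the crux for ONE force; `x_iff` (definitional).
* §1 `IsRelaxed ν f μ` = RELAXED stationary statistics on the Leray ball (cylindrical Liouville + ONE
  global energy inequality; the exact dual class of the crux's floor certificates, sibling crux
  `FloorCertificate`, cards dissipation-deficit-duality / floor-minimax-dissipation-tightness);
  `fmrtIsRelaxed_holds` : every FMRT stationary statistical solution is relaxed (PROVED from tree facts).
* §2 card `ceiling-first-fixed-ball`: `RelaxedCeilingFor`, `BoundedEnergyLoudFor`, `FloorMinimaxFor`;
  glue `xFor_of_ceilingFirst`, `target_of_ceilingFirst` (PROVED, pure logic).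
* §3 card `kolmogorov-number-pinning`: `UniformBetaFor` (β(μ) = ν∫‖∇u‖² / (∫|u|²)^{3/2} ≥ β₀ on relaxed
  statistics), `EnergyFloorFor`; `loudAll_of_beta`, `relaxedCeiling_of_beta`, `xFor_of_beta` (PROVED);
  converse `betaFMRT_of_xFor` (PROVED): X pins β below on the FMRT class.

No statement of the crux is restated or weakened: every glue theorem concludes `XFor f` /
`FloorCertificateEnsembleCeiling` BY NAME.
-/

noncomputable section

set_option linter.dupNamespace false

open MeasureTheory
open scoped ENNReal InnerProductSpace

namespace Summit.AnomalousDissipation.AnomalousDissipation.Cruxes.FloorCertificateEnsembleCeiling.SketchIdeator3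

open Literature.Analysis.FunctionSpaces Literature.Analysis.FluidPDE
open Summit.AnomalousDissipation.AnomalousDissipation.Theses.TaylorCertificates
open Summit.AnomalousDissipation.AnomalousDissipation.Theorems.FloorCertificate.Negative

/-- the flat 3-torus -/
local notation "𝕋³" => UnitAddTorus (Fin 3)
/-- velocity values -/
local notation "E³" => EuclideanSpace ℝ (Fin 3)
/-- the energy space `H` -/
local notation "ℍ" => Torus.energySpace (Fin 3)
/-- `L²(T³; ℝ³)` -/
local notation "L2" => (Lp (EuclideanSpace ℝ (Fin 3)) 2 (volume : Measure (UnitAddTorus (Fin 3))))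

/-- The (extended, spectral) enstrophy `‖∇u‖² ∈ [0,∞]` of a state `u ∈ H`. -/
def enst (u : ℍ) : ℝ≥0∞ := Torus.eGradNormSq ((u : L2) : 𝕋³ → E³)

/-! ## §0 The crux for ONE force -/

/-- The CEILING clause of the crux at one viscosity: every FMRT stationary statistical solution of
`NS_ν(f)` with integrable energy has mean energy `≤ E` (verbatim the second conjunct of X). -/
def CeilingClause (ν : ℝ) (f : 𝕋³ → E³) (E : ℝ) : Prop :=
  ∀ μ : Measure ℍ, Torus.IsStationaryStatisticalSolution ν f μ →
    Integrable (fun v : ℍ => ‖v‖ ^ 2) μ → Torus.ensembleEnergy μ ≤ E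

/-- `X` for ONE force `f` (the inner block of `FloorCertificateEnsembleCeiling` after `∃ f, smooth ∧
divfree ∧ meanzero ∧ …`): budgets `ε₀, E, ν₀` with the FLOOR family (`FloorFamily`, landed
`Negative/WeakDuality`) and the CEILING clause at every `ν ∈ (0, ν₀)`. -/
def XFor (f : 𝕋³ → E³) : Prop :=
  ∃ (ε₀ E ν₀ : ℝ), 0 < ε₀ ∧ 0 < ν₀ ∧ ∀ ν : ℝ, 0 < ν → ν < ν₀ → FloorFamily f ε₀ ν ∧ CeilingClause ν f E

/-- The crux unbundled (definitional). -/
theorem x_iff : FloorCertificateEnsembleCeiling ↔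
    ∃ f : 𝕋³ → E³, Torus.IsSmooth f ∧ Torus.IsDivFree f ∧ Torus.HasZeroMean f ∧ XFor f :=
  Iff.rfl

/-! ## §1 Relaxed stationary statistics on the Leray ball -/

/-- RELAXED stationary statistics of `NS_ν(f)` on the Leray ball `|u|² ≤ 16‖f‖²/ν²`: Borel
probability measures on `H` carried by the ball, of finite mean enstrophy, satisfying the stationary
Liouville equation for every cylindrical test functional and ONE global energy inequality
`ν∫‖∇u‖² dμ ≤ ∫(u,f) dμ`. The exact Lagrangian dual of the crux's floor certificates (sibling crux
`FloorCertificate`: weak duality proved in tree spirit below; strong duality = `FloorMinimaxFor`). -/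
structure IsRelaxed (ν : ℝ) (f : 𝕋³ → E³) (μ : Measure ℍ) : Prop where
  prob : IsProbabilityMeasure μ
  ball : ∀ᵐ u ∂μ, ‖u‖ ^ 2 ≤ 16 * (∫ x, ‖f x‖ ^ 2) / ν ^ 2
  enstrophy_finite : ∫⁻ u, enst u ∂μ < ∞
  liouville : ∀ Φ : Torus.CylindricalTest (Fin 3),
    Integrable (fun u => Torus.nsGeneratorPairing ν f u (Φ.grad u)) μ ∧
      ∫ u, Torus.nsGeneratorPairing ν f u (Φ.grad u) ∂μ = 0
  pairing_integrable : Integrable (fun u : ℍ => Torus.pairing (u : L2) f) μ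
  energy_le : ν * (∫⁻ u, enst u ∂μ).toReal ≤ ∫ u, Torus.pairing (u : L2) f ∂μ

/-- The mean dissipation of the tree is `ν ∫ enst dμ` (definitional bookkeeping). -/
theorem ensembleDissipation_eq (ν : ℝ) (μ : Measure ℍ) :
    Torus.ensembleDissipation ν μ = ν * (∫⁻ u, enst u ∂μ).toReal := rfl

/-- **FMRT ⊂ relaxed** (provable now, proved): a stationary statistical solution in the sense of
FMRT IV Def. 1.3 (`IsStationaryStatisticalSolution`) with `ν > 0` and `f ∈ L²` is a relaxed stationary
statistic on the Leray ball: support bound (1.34) `ae_norm_le` + `ball_of_norm_le`, the global energy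
inequality `energy_le_holds` ((1.31) with `e₁ = 0, e₂ = ∞`), integrability of the pairing. -/
theorem isRelaxed_of_fmrt {ν : ℝ} (hν : 0 < ν) {f : 𝕋³ → E³} (hf : MemLp f 2 volume) {μ : Measure ℍ}
    (hμ : Torus.IsStationaryStatisticalSolution ν f μ) : IsRelaxed ν f μ where
  prob := hμ.prob
  ball := by
    filter_upwards [hμ.ae_norm_le hν hf] with u hu
    exact ball_of_norm_le hν hf hu
  enstrophy_finite := hμ.enstrophy_finite
  liouville := hμ.generator
  pairing_integrable := hμ.integrable_pairing hf
  energy_le := Torus.IsStationaryStatisticalSolution.energy_le_holds hμ hf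

/-- Named form used by the glue theorems. -/
def FMRTIsRelaxed : Prop :=
  ∀ (ν : ℝ) (f : 𝕋³ → E³) (μ : Measure ℍ), 0 < ν → Torus.IsSmooth f →
    Torus.IsStationaryStatisticalSolution ν f μ → IsRelaxed ν f μ

theorem fmrtIsRelaxed_holds : FMRTIsRelaxed :=
  fun _ _ _ hν hf hμ => isRelaxed_of_fmrt hν (hf.memLp 2) hμ

/-- Under a relaxed statistic the energy `‖u‖²` is integrable (bounded a.e. by the ball). -/
theorem IsRelaxed.integrable_norm_sq {ν : ℝ} {f : 𝕋³ → E³} {μ : Measure ℍ} (hμ : IsRelaxed ν f μ) :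
    Integrable (fun u : ℍ => ‖u‖ ^ 2) μ := by
  haveI := hμ.prob
  refine Integrable.mono' (integrable_const (16 * (∫ x, ‖f x‖ ^ 2) / ν ^ 2))
    (continuous_norm.pow 2).aestronglyMeasurable ?_
  filter_upwards [hμ.ball] with u hu
  rw [Real.norm_of_nonneg (sq_nonneg _)]
  exact hu

/-- Under a relaxed statistic the norm `‖u‖` is integrable. -/
theorem IsRelaxed.integrable_norm {ν : ℝ} {f : 𝕋³ → E³} {μ : Measure ℍ} (hμ : IsRelaxed ν f μ) :
    Integrable (fun u : ℍ => ‖u‖) μ := by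
  haveI := hμ.prob
  refine Integrable.mono' ((integrable_const (1 : ℝ)).add hμ.integrable_norm_sq)
    continuous_norm.aestronglyMeasurable (ae_of_all _ fun u => ?_)
  rw [Real.norm_of_nonneg (norm_nonneg _), Pi.add_apply]
  nlinarith [norm_nonneg u, sq_nonneg (‖u‖ - 1)]

/-- The elementary injection bound for a relaxed statistic:
`ε(μ) = ν∫‖∇u‖² ≤ ∫(u,f) ≤ ‖f‖_{L²} ∫‖u‖ ≤ ‖f‖_{L²} (∫‖u‖² + 1)/2`. -/
theorem IsRelaxed.dissipation_le {ν : ℝ} {f : 𝕋³ → E³} (hf : MemLp f 2 volume) {μ : Measure ℍ}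
    (hμ : IsRelaxed ν f μ) :
    Torus.ensembleDissipation ν μ ≤ ‖hf.toLp f‖ * ((Torus.ensembleEnergy μ + 1) / 2) := by
  haveI := hμ.prob
  have h1 : Torus.ensembleDissipation ν μ ≤ ∫ u, Torus.pairing (u : L2) f ∂μ := hμ.energy_le
  have h2 : ∫ u, Torus.pairing (u : L2) f ∂μ ≤ ∫ u, ‖hf.toLp f‖ * ((‖u‖ ^ 2 + 1) / 2) ∂μ := by
    refine integral_mono hμ.pairing_integrable
      (((hμ.integrable_norm_sq.add (integrable_const 1)).div_const 2).const_mul _) fun u => ?_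
    have hcs := (le_abs_self _).trans (Torus.abs_pairing_coe_le hf u)
    have hamgm : ‖u‖ ≤ (‖u‖ ^ 2 + 1) / 2 := by nlinarith [sq_nonneg (‖u‖ - 1)]
    calc Torus.pairing (u : L2) f ≤ ‖u‖ * ‖hf.toLp f‖ := hcs
      _ = ‖hf.toLp f‖ * ‖u‖ := by ring
      _ ≤ ‖hf.toLp f‖ * ((‖u‖ ^ 2 + 1) / 2) := by gcongr
  have h3 : ∫ u, ‖hf.toLp f‖ * ((‖u‖ ^ 2 + 1) / 2) ∂μ =
      ‖hf.toLp f‖ * ((Torus.ensembleEnergy μ + 1) / 2) := by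
    rw [integral_const_mul]
    congr 1
    rw [integral_div, integral_add hμ.integrable_norm_sq (integrable_const 1)]
    simp [Torus.ensembleEnergy]
  linarith [h3 ▸ h2]

/-! ## §2 Card `ceiling-first-fixed-ball`

Order the two halves: the CEILING in the relaxed class first; it confines the floor's dual problem to a
ν-INDEPENDENT energy budget `E`, so loudness is only needed for relaxed statistics of mean energy `≤ E`. -/

/-- Stub C_rel: the ensemble ceiling in the RELAXED class (⊇ FMRT ∩ ball): some `E, ν₁` such that every
relaxed stationary statistic of `NS_ν(f)`, `ν < ν₁`, has mean energy `≤ E`. (Implies the crux's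
ceiling clause by `isRelaxed_of_fmrt`; implied by any unrestricted ceiling CERTIFICATE by weak duality.) -/
def RelaxedCeilingFor (f : 𝕋³ → E³) : Prop :=
  ∃ (E ν₁ : ℝ), 0 < ν₁ ∧ ∀ ν : ℝ, 0 < ν → ν < ν₁ →
    ∀ μ : Measure ℍ, IsRelaxed ν f μ → Torus.ensembleEnergy μ ≤ E

/-- Stub L_E: LOUDNESS AT BOUNDED ENERGY — for every energy budget `E` there are `ε₀, ν₂` such that
every relaxed stationary statistic of `NS_ν(f)`, `ν < ν₂`, WITH MEAN ENERGY `≤ E` dissipates at least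
`ε₀`. Its dual enemies are quiet statistics of O(1) energy only (Chebyshev: mass `≤ E/R²` outside the
ball of radius `R`): the warm window `1 ≪ |u|² ≪ ν⁻¹` is the ceiling's business. -/
def BoundedEnergyLoudFor (f : 𝕋³ → E³) : Prop :=
  ∀ E : ℝ, ∃ (ε₀ ν₂ : ℝ), 0 < ε₀ ∧ 0 < ν₂ ∧ ∀ ν : ℝ, 0 < ν → ν < ν₂ →
    ∀ μ : Measure ℍ, IsRelaxed ν f μ → Torus.ensembleEnergy μ ≤ E → ε₀ ≤ Torus.ensembleDissipation ν μ

/-- Stub M (the sibling FLOOR MINIMAX theorem, paper-proved in Cruxes/FloorCertificate, cards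
dissipation-tight-minimax / floor-minimax-dissipation-tightness, triage r1 pass ×3): at fixed `ν > 0`,
if every relaxed stationary statistic on the Leray ball dissipates `≥ ε₀`, then for every `ε < ε₀` a
floor family `(Φ₁, θ₁ ≤ 0)` with floor `ε` exists (`sup{ε : FloorFamily f ε ν} = min_𝓡 ν∫‖∇u‖²dμ`,
dissipation is inf-compact on the ball ⇒ no duality gap; Sion / lopsided Kneser–Fan). -/
def FloorMinimaxFor (f : 𝕋³ → E³) : Prop :=
  ∀ (ν ε₀ ε : ℝ), 0 < ν → ε < ε₀ →
    (∀ μ : Measure ℍ, IsRelaxed ν f μ → ε₀ ≤ Torus.ensembleDissipation ν μ) → FloorFamily f ε ν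

/-- **GLUE of card `ceiling-first-fixed-ball` (proved, pure logic):** for one force,
`RelaxedCeilingFor f → BoundedEnergyLoudFor f → FloorMinimaxFor f → XFor f` (with `FMRT ⊂ relaxed`).
Budgets: `ε₀/2`, the ceiling's `E`, `ν₀ = min ν₁ ν₂(E)`. -/
theorem xFor_of_ceilingFirst {f : 𝕋³ → E³} (hf : Torus.IsSmooth f) (hR : FMRTIsRelaxed)
    (hC : RelaxedCeilingFor f) (hL : BoundedEnergyLoudFor f) (hM : FloorMinimaxFor f) : XFor f := by
  obtain ⟨E, ν₁, hν₁, hceil⟩ := hC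
  obtain ⟨ε₀, ν₂, hε₀, hν₂, hloud⟩ := hL E
  refine ⟨ε₀ / 2, E, min ν₁ ν₂, by positivity, lt_min hν₁ hν₂, fun ν hν hνlt => ⟨?_, ?_⟩⟩
  · have h1 : ν < ν₁ := lt_of_lt_of_le hνlt (min_le_left _ _)
    have h2 : ν < ν₂ := lt_of_lt_of_le hνlt (min_le_right _ _)
    exact hM ν ε₀ (ε₀ / 2) hν (by linarith) fun μ hμ => hloud ν hν h2 μ hμ (hceil ν hν h1 μ hμ)
  · intro μ hμ _
    exact hceil ν hν (lt_of_lt_of_le hνlt (min_le_left _ _)) μ (hR ν f μ hν hf hμ)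

/-- **The card's line concludes the crux BY NAME:** one smooth solenoidal mean-zero `f` carrying the two
stubs, plus the minimax theorem for that `f`, gives `FloorCertificateEnsembleCeiling`. -/
theorem target_of_ceilingFirst
    (h : ∃ f : 𝕋³ → E³, Torus.IsSmooth f ∧ Torus.IsDivFree f ∧ Torus.HasZeroMean f ∧
      RelaxedCeilingFor f ∧ BoundedEnergyLoudFor f ∧ FloorMinimaxFor f) :
    FloorCertificateEnsembleCeiling := by
  obtain ⟨f, hfs, hfd, hfz, hC, hL, hM⟩ := h
  exact x_iff.2 ⟨f, hfs, hfd, hfz, xFor_of_ceilingFirst hfs fmrtIsRelaxed_holds hC hL hM⟩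

/-- Sanity (the split is exact on the loudness side): relaxed ceiling + loudness at bounded energy give
loudness of ALL relaxed statistics, uniformly — the hypothesis FloorMinimax consumes. -/
theorem loudAll_of_ceilingFirst {f : 𝕋³ → E³} (hC : RelaxedCeilingFor f) (hL : BoundedEnergyLoudFor f) :
    ∃ (ε₀ ν₀ : ℝ), 0 < ε₀ ∧ 0 < ν₀ ∧ ∀ ν : ℝ, 0 < ν → ν < ν₀ →
      ∀ μ : Measure ℍ, IsRelaxed ν f μ → ε₀ ≤ Torus.ensembleDissipation ν μ := by
  obtain ⟨E, ν₁, hν₁, hceil⟩ := hC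
  obtain ⟨ε₀, ν₂, hε₀, hν₂, hloud⟩ := hL E
  exact ⟨ε₀, min ν₁ ν₂, hε₀, lt_min hν₁ hν₂, fun ν hν hνlt μ hμ =>
    hloud ν hν (lt_of_lt_of_le hνlt (min_le_right _ _)) μ hμ
      (hceil ν hν (lt_of_lt_of_le hνlt (min_le_left _ _)) μ hμ)⟩

/-! ### §2b The floor core after ceiling-first: quiet bounded-energy statistics accumulate at
work-free `H¹` Euler ensembles of the SAME force at FULL strength (no blow-down: energy is O(1)). -/

/-- Stub K2a — `H¹`-EULER COERCIVITY OF THE FORCE IN THE ENSEMBLE SENSE: `f` carries NO stationary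
statistical solution of the FORCED EULER equations (the tree predicate at `ν = 0`: finite mean enstrophy,
cylindrical Liouville `∫⟨f − B(u,u), Φ'(u)⟩dη = 0`, shellwise injection `∫_{shell}(u,f)dη ≥ 0`) on which
the force does no net work and whose mean energy is at most `E`. Dirac case: no finite-energy `H¹` weak
Euler "dodger" `P[(v·∇)v] = f` — the `H¹`/ensemble upgrade of crux #6 `SmoothEulerCoerciveForce`
(designer forces `f = P[(v·∇)v]` fail it). No stationary h-principle reaches `H¹` (all are `L^∞`/`C^α`,
α small), so this is open, not known-false. -/
def H1EulerCoerciveFor (f : 𝕋³ → E³) : Prop :=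
  ∀ (E : ℝ) (η : Measure ℍ), Torus.IsStationaryStatisticalSolution 0 f η →
    ∫ u, Torus.pairing (u : L2) f ∂η = 0 → Torus.ensembleEnergy η ≤ E →
      Integrable (fun v : ℍ => ‖v‖ ^ 2) η → False

/-- Stub K2b — TAMENESS OF QUIET STATISTICS AT BOUNDED ENERGY (the dynamical residue, stated as the
contrapositive of a compactness theorem): if loudness at energy budget `E` FAILS along `ν → 0`, then the
quiet relaxed statistics accumulate (tightness in `H`-norm: no O(1)-energy escape to high frequencies —
"no purgatory"; passage to the limit in Liouville, the viscous term vanishing; limit of finite mean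
enstrophy) at a work-free `H¹` Euler ensemble of `f` of mean energy `≤ E`. Its failure mode is exactly the
h-principle frontier: rough quiet NS-selected statistics of O(1) energy. -/
def TameQuietFor (f : 𝕋³ → E³) : Prop :=
  ∀ E : ℝ, (¬ ∃ (ε₀ ν₂ : ℝ), 0 < ε₀ ∧ 0 < ν₂ ∧ ∀ ν : ℝ, 0 < ν → ν < ν₂ →
      ∀ μ : Measure ℍ, IsRelaxed ν f μ → Torus.ensembleEnergy μ ≤ E → ε₀ ≤ Torus.ensembleDissipation ν μ) →
    ∃ η : Measure ℍ, Torus.IsStationaryStatisticalSolution 0 f η ∧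
      ∫ u, Torus.pairing (u : L2) f ∂η = 0 ∧ Torus.ensembleEnergy η ≤ E ∧
        Integrable (fun v : ℍ => ‖v‖ ^ 2) η

/-- GLUE (proved, classical logic): tameness + `H¹`-Euler coercivity give loudness at every energy
budget — the floor core of the ceiling-first line is an INVISCID rigidity statement about `f` at full
strength plus one compactness theorem. -/
theorem boundedEnergyLoud_of_tame_coercive {f : 𝕋³ → E³} (hT : TameQuietFor f)
    (hK : H1EulerCoerciveFor f) : BoundedEnergyLoudFor f := by
  intro E
  by_contra h
  obtain ⟨η, hη, hwork, hE, hint⟩ := hT E h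
  exact hK E η hη hwork hE hint

/-- The full ceiling-first skeleton concludes the crux BY NAME from four stubs:
relaxed ceiling (C_rel), tameness (K2b), `H¹`-Euler coercivity (K2a), floor minimax (M). -/
theorem target_of_ceilingFirst_skeleton
    (h : ∃ f : 𝕋³ → E³, Torus.IsSmooth f ∧ Torus.IsDivFree f ∧ Torus.HasZeroMean f ∧
      RelaxedCeilingFor f ∧ TameQuietFor f ∧ H1EulerCoerciveFor f ∧ FloorMinimaxFor f) :
    FloorCertificateEnsembleCeiling := by
  obtain ⟨f, hfs, hfd, hfz, hC, hT, hK, hM⟩ := h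
  exact target_of_ceilingFirst ⟨f, hfs, hfd, hfz, hC, boundedEnergyLoud_of_tame_coercive hT hK, hM⟩

/-! ## §3 Card `kolmogorov-number-pinning`

The Kolmogorov number (dissipation constant) of a measure, `β(μ) = ν∫‖∇u‖²dμ / (∫|u|²dμ)^{3/2}`,
is invariant under the exact dimensional covariance `(u, ν, f) ↦ (u/A, ν/A, f/A²)` of the relaxed and
FMRT classes. Transfer: `X(f) ⇐ β ≥ β₀` on relaxed statistics (+ the trivial energy floor + minimax),
and `X(f) ⇒ β ≥ ε₀/E^{3/2}` on FMRT statistics. -/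

/-- C⁺ of the card: a UNIFORM KOLMOGOROV NUMBER — some `β₀, ν₀ > 0` with
`β₀ · e(μ) · √e(μ) ≤ ε(μ)` (`e` = mean energy, `ε` = mean dissipation) for every relaxed stationary
statistic of `NS_ν(f)`, `ν < ν₀`. One homogeneous (degree-3) inequality; no certificate, no `E`, no `ε₀`. -/
def UniformBetaFor (f : 𝕋³ → E³) : Prop :=
  ∃ (β₀ ν₀ : ℝ), 0 < β₀ ∧ 0 < ν₀ ∧ ∀ ν : ℝ, 0 < ν → ν < ν₀ → ∀ μ : Measure ℍ, IsRelaxed ν f μ →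
    β₀ * Torus.ensembleEnergy μ * Real.sqrt (Torus.ensembleEnergy μ) ≤ Torus.ensembleDissipation ν μ

/-- The ENERGY FLOOR (provable now, routine): relaxed statistics of a nonzero force cannot sit near
rest — Liouville with the linear test field `g = f` gives `‖f‖² = −ν∫(u,Δf)dμ + ∫∫(u⊗u):∇f dμ ≤
ν‖Δf‖√e + ‖∇f‖_∞ e`, whence `e(μ) ≥ e₀(f) > 0` for `ν ≤ 1`. Stated as a stub. -/
def EnergyFloorFor (f : 𝕋³ → E³) : Prop :=
  ∃ (e₀ ν₃ : ℝ), 0 < e₀ ∧ 0 < ν₃ ∧ ∀ ν : ℝ, 0 < ν → ν < ν₃ →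
    ∀ μ : Measure ℍ, IsRelaxed ν f μ → e₀ ≤ Torus.ensembleEnergy μ

/-- β-floor + energy floor ⇒ uniform loudness of ALL relaxed statistics (`ε₀ = β₀ e₀ √e₀`). PROVED. -/
theorem loudAll_of_beta {f : 𝕋³ → E³} (hB : UniformBetaFor f) (hE : EnergyFloorFor f) :
    ∃ (ε₀ ν₀ : ℝ), 0 < ε₀ ∧ 0 < ν₀ ∧ ∀ ν : ℝ, 0 < ν → ν < ν₀ →
      ∀ μ : Measure ℍ, IsRelaxed ν f μ → ε₀ ≤ Torus.ensembleDissipation ν μ := by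
  obtain ⟨β₀, ν₀, hβ₀, hν₀, hβ⟩ := hB
  obtain ⟨e₀, ν₃, he₀, hν₃, he⟩ := hE
  refine ⟨β₀ * e₀ * Real.sqrt e₀, min ν₀ ν₃, by positivity, lt_min hν₀ hν₃, fun ν hν hνlt μ hμ => ?_⟩
  have h0 : ν < ν₀ := lt_of_lt_of_le hνlt (min_le_left _ _)
  have h3 : ν < ν₃ := lt_of_lt_of_le hνlt (min_le_right _ _)
  have hle : e₀ ≤ Torus.ensembleEnergy μ := he ν hν h3 μ hμ
  have hsq : Real.sqrt e₀ ≤ Real.sqrt (Torus.ensembleEnergy μ) := Real.sqrt_le_sqrt hle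
  have he0' : 0 ≤ Torus.ensembleEnergy μ := integral_nonneg fun u => by positivity
  have h1 : β₀ * e₀ ≤ β₀ * Torus.ensembleEnergy μ := mul_le_mul_of_nonneg_left hle hβ₀.le
  have h2 : β₀ * e₀ * Real.sqrt e₀ ≤ β₀ * Torus.ensembleEnergy μ * Real.sqrt e₀ :=
    mul_le_mul_of_nonneg_right h1 (Real.sqrt_nonneg _)
  have h4 : β₀ * Torus.ensembleEnergy μ * Real.sqrt e₀ ≤
      β₀ * Torus.ensembleEnergy μ * Real.sqrt (Torus.ensembleEnergy μ) :=
    mul_le_mul_of_nonneg_left hsq (mul_nonneg hβ₀.le he0')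
  exact (h2.trans h4).trans (hβ ν hν h0 μ hμ)

/-- β-floor ⇒ the relaxed CEILING with `E = max 1 (‖f‖_{L²}/β₀)²`: from `β₀ e √e ≤ ε ≤ ‖f‖(e+1)/2 ≤ ‖f‖ e`
for `e ≥ 1`, i.e. `β₀ √e ≤ ‖f‖`. PROVED. -/
theorem relaxedCeiling_of_beta {f : 𝕋³ → E³} (hf : Torus.IsSmooth f) (hB : UniformBetaFor f) :
    RelaxedCeilingFor f := by
  obtain ⟨β₀, ν₀, hβ₀, hν₀, hβ⟩ := hB
  have hf2 : MemLp f 2 volume := hf.memLp 2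
  set F : ℝ := ‖hf2.toLp f‖ with hF
  have hF0 : 0 ≤ F := norm_nonneg _
  refine ⟨max 1 ((F / β₀) ^ 2), ν₀, hν₀, fun ν hν hνlt μ hμ => ?_⟩
  set e : ℝ := Torus.ensembleEnergy μ with he
  by_cases h1 : e ≤ 1
  · exact h1.trans (le_max_left _ _)
  · push Not at h1
    have hup : Torus.ensembleDissipation ν μ ≤ F * ((e + 1) / 2) := hμ.dissipation_le hf2
    have hlow : β₀ * e * Real.sqrt e ≤ Torus.ensembleDissipation ν μ := hβ ν hν hνlt μ hμ
    have hs0 : 0 < Real.sqrt e := Real.sqrt_pos.2 (by linarith)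
    have hs1 : 1 ≤ Real.sqrt e := by
      rw [show (1 : ℝ) = Real.sqrt 1 from Real.sqrt_one.symm]
      exact Real.sqrt_le_sqrt h1.le
    -- `β₀ e √e ≤ F (e+1)/2 ≤ F e`, so `β₀ √e ≤ F`
    have hchain : β₀ * e * Real.sqrt e ≤ F * e := by
      have : F * ((e + 1) / 2) ≤ F * e := by
        apply mul_le_mul_of_nonneg_left _ hF0
        linarith
      linarith
    have hbs : β₀ * Real.sqrt e ≤ F := by
      have he0 : 0 < e := by linarith
      have : (β₀ * Real.sqrt e) * e ≤ F * e := by nlinarith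
      exact le_of_mul_le_mul_right this he0
    have hsq : Real.sqrt e ≤ F / β₀ := by
      rw [le_div_iff₀ hβ₀]; linarith [mul_comm β₀ (Real.sqrt e)]
    have : e ≤ (F / β₀) ^ 2 := by
      have h := pow_le_pow_left₀ hs0.le hsq 2
      rwa [Real.sq_sqrt (by linarith)] at h
    exact this.trans (le_max_right _ _)

/-- **GLUE of card `kolmogorov-number-pinning` (proved):** `UniformBetaFor f → EnergyFloorFor f →
FloorMinimaxFor f → XFor f`. The two halves of X come out of ONE inequality: the ceiling by
`relaxedCeiling_of_beta`, the floor by `loudAll_of_beta` + minimax. -/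
theorem xFor_of_beta {f : 𝕋³ → E³} (hf : Torus.IsSmooth f) (hB : UniformBetaFor f)
    (hE : EnergyFloorFor f) (hM : FloorMinimaxFor f) : XFor f := by
  obtain ⟨E, ν₁, hν₁, hceil⟩ := relaxedCeiling_of_beta hf hB
  obtain ⟨ε₀, ν₄, hε₀, hν₄, hloud⟩ := loudAll_of_beta hB hE
  refine ⟨ε₀ / 2, E, min ν₁ ν₄, by positivity, lt_min hν₁ hν₄, fun ν hν hνlt => ⟨?_, ?_⟩⟩
  · exact hM ν ε₀ (ε₀ / 2) hν (by linarith)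
      fun μ hμ => hloud ν hν (lt_of_lt_of_le hνlt (min_le_right _ _)) μ hμ
  · intro μ hμ _
    exact hceil ν hν (lt_of_lt_of_le hνlt (min_le_left _ _)) μ (isRelaxed_of_fmrt hν (hf.memLp 2) hμ)

/-- The β-line concludes the crux BY NAME. -/
theorem target_of_beta
    (h : ∃ f : 𝕋³ → E³, Torus.IsSmooth f ∧ Torus.IsDivFree f ∧ Torus.HasZeroMean f ∧
      UniformBetaFor f ∧ EnergyFloorFor f ∧ FloorMinimaxFor f) :
    FloorCertificateEnsembleCeiling := by
  obtain ⟨f, hfs, hfd, hfz, hB, hE, hM⟩ := h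
  exact x_iff.2 ⟨f, hfs, hfd, hfz, xFor_of_beta hfs hB hE hM⟩

/-- **Converse (proved): X pins the Kolmogorov number below on the FMRT class.** Under `XFor f`, every
FMRT stationary statistical solution of `NS_ν(f)`, `ν < ν₀`, has `(ε₀ / (E' √E')) · e √e ≤ ε(μ)` with
`E' = max E 1` — weak duality (landed `floorFamily_le_ensembleDissipation`) for the numerator, the
ceiling clause for the denominator. So on the physical class C⁺ and X differ only by relaxed ⊋ FMRT. -/
theorem betaFMRT_of_xFor {f : 𝕋³ → E³} (hf : Torus.IsSmooth f) (hX : XFor f) :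
    ∃ (β₀ ν₀ : ℝ), 0 < β₀ ∧ 0 < ν₀ ∧ ∀ ν : ℝ, 0 < ν → ν < ν₀ → ∀ μ : Measure ℍ,
      Torus.IsStationaryStatisticalSolution ν f μ →
        β₀ * Torus.ensembleEnergy μ * Real.sqrt (Torus.ensembleEnergy μ) ≤ Torus.ensembleDissipation ν μ := by
  obtain ⟨ε₀, E, ν₀, hε₀, hν₀, hX⟩ := hX
  have hf2 : MemLp f 2 volume := hf.memLp 2
  set E' : ℝ := max E 1 with hE'
  have hE'1 : 1 ≤ E' := le_max_right _ _
  have hE'0 : 0 < E' := by linarith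
  have hsE' : 0 < Real.sqrt E' := Real.sqrt_pos.2 hE'0
  refine ⟨ε₀ / (E' * Real.sqrt E'), ν₀, by positivity, hν₀, fun ν hν hνlt μ hμ => ?_⟩
  obtain ⟨hfloor, hceil⟩ := hX ν hν hνlt
  have hdiss : ε₀ ≤ Torus.ensembleDissipation ν μ := floorFamily_le_ensembleDissipation hν hf2 hfloor hμ
  have he : Torus.ensembleEnergy μ ≤ E' := (hceil μ hμ hμ.integrable_norm_sq).trans (le_max_left _ _)
  have he0 : 0 ≤ Torus.ensembleEnergy μ := integral_nonneg fun u => by positivity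
  have hs : Real.sqrt (Torus.ensembleEnergy μ) ≤ Real.sqrt E' := Real.sqrt_le_sqrt he
  have hs0 : 0 ≤ Real.sqrt (Torus.ensembleEnergy μ) := Real.sqrt_nonneg _
  calc ε₀ / (E' * Real.sqrt E') * Torus.ensembleEnergy μ * Real.sqrt (Torus.ensembleEnergy μ)
      ≤ ε₀ / (E' * Real.sqrt E') * E' * Real.sqrt E' := by gcongr
    _ = ε₀ := by field_simp
    _ ≤ Torus.ensembleDissipation ν μ := hdiss

end Summit.AnomalousDissipation.AnomalousDissipation.Cruxes.FloorCertificateEnsembleCeiling.SketchIdeator3
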